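import Summits.ResolutionOfSingularities.ResolutionOfSingularities.Theorems.HilbertSamuelEliminationSigmaMaxModificationsCorridor3WLadderIsoTailsTowerBaseChangeAssembly
import Mathlib.FieldTheory.IsSepClosed
import Mathlib.FieldTheory.SeparableClosure
import Summits.ResolutionOfSingularities.ResolutionOfSingularities.Theorems.HilbertSamuelEliminationSigmaMaxModificationsCorridor3WLadderIsoTailsTowerDrop
import HarnessLib

/-!
# [OURS · L1 W4.2] K2-sep ROUTE A, the LAST brick: **`K`-RATIONAL MARKED POINTS of the base-changed tower** — over a point tower whose residue
# field STEPS `κ(x_n) → κ(x_{n+1})` are SEPARABLE and whose origin admits a `k`-embedding `κ(x_0) → K` into a separably closed `K`, the base change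
# `S_• = X_• ×_k K` carries marked points `s_n` over `x_n` that are `K`-RATIONAL (sections `Spec K → S_n` of the structure maps, built by
# `IsSepClosed.lift` step by step and `pullback.lift`); hence every base-changed step is RATIONAL, and with
# `false_of_isIsoPointTower_baseChangeGR_of_forall_free` the K2-sep reduction closes:
# **an isolated point tower with separable residue steps over such an origin is not everywhere free.**
# (crux `SigmaMaxModifications` stmt-ResolutionOfSingularities-18506 / conjunct stmt-…-19249; line `w_ladder_rows` v8.5, registered stub
# `stub_isoSepRecurrent`; res-L1-w42-plan-1 WORD 2026-08-27T16:25:47Z; design `L/res-L1-w42-stub-2/k2sep/K2SEP-DESIGN.md` §11)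

Prover res-L1-w42-stub-2 (gen 5). Helper file `--supports stmt-ResolutionOfSingularities-19249 --as helper`; no definitions, no named fact. OURS
(cell res-hironaka, slot W4.2); NOT statements of [Hironaka2017] nor of [CossartJannsenSaito2020]. AI-written; AI review is weaker than expert
review.

* `surjective_residueFieldMap_of_section` — a section `σ` of `h : S → B` makes `κ(h σ b) → κ(σ b)` onto.
* `exists_residueField_hom_comp_eq` — one separable step: `ε : κ(π x′) → K` (`K` separably closed) extends along `κ(π x′) → κ(x′)`.
* **`BlowupTower.exists_rational_markedPoints_bc`** — `K`-rational marked points `s_n` of the base change over `pt_n`.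
* **`false_of_isIsoPointTower_of_separableSteps_of_forall_free`** / **`exists_isSatelliteStep_of_isIsoPointTower_of_separableSteps`**
  (`K = k^{sep}`) — THE K2-sep THEOREM; **`satelliteRecurrent_of_isIsoPointTower_of_separableSteps`** — on every tail, so
  «separable residues ⟹ satellite-recurrent» (`∀ a, ∃ n ≥ a, IsSatelliteStep T pt n`) (free towers with separable residue steps are impossible
  over a maximal origin whose residue field embeds `k`-linearly into a separably closed separable-algebraic `K ⊇ k`).

[OURS · L1 W4.2; AI-written] [cite: CossartJannsenSaito2020, Def. 6.38, p. 107] [cite: CossartPiltant2009, ch. 3 I.9]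
-/

set_option linter.dupNamespace false

noncomputable section

open CategoryTheory CategoryTheory.Limits AlgebraicGeometry TopologicalSpace IsLocalRing
open Literature.AlgebraicGeometry.Resolution Literature.AlgebraicGeometry.CossartJannsenSaito2020
open Summit.ResolutionOfSingularities.ResolutionOfSingularities.Theorems.CampaignW42
open Summit.ResolutionOfSingularities.ResolutionOfSingularities.Cruxes.SigmaMaxModifications.IdeasL1Idea2R4
open Summit.ResolutionOfSingularities.ResolutionOfSingularities.Cruxes.SigmaMaxModifications.IdeasL1C5

namespace Summit.ResolutionOfSingularities.ResolutionOfSingularities.Theorems.SigmaMaxModificationsCorridor3.IsoTailsHS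

universe u

/-! ## §1. Sections give rational points -/

/-- **A section makes the residue field map onto**: if `σ ≫ h = 𝟙_B` then `κ(h(σ b)) → κ(σ b)` is surjective (the composite with the injective
`κ(σ b) → κ(b)` is an isomorphism). [folklore] -/
theorem surjective_residueFieldMap_of_section {S B : Scheme.{u}} (h : S ⟶ B) (σ : B ⟶ S) (hσ : σ ≫ h = 𝟙 B) (b : B) :
    Function.Surjective (h.residueFieldMap (σ.base b)).hom := by
  have hc : (σ ≫ h).residueFieldMap b = h.residueFieldMap (σ.base b) ≫ σ.residueFieldMap b := Scheme.residueFieldMap_comp σ h b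
  rw [Scheme.Hom.residueFieldMap_congr hσ b, Scheme.residueFieldMap_id] at hc
  erw [Category.comp_id] at hc
  -- `hc : e.hom = a ≫ bb` with `e` an isomorphism and `bb` injective
  have hinj : Function.Injective (σ.residueFieldMap b).hom := (σ.residueFieldMap b).hom.injective
  obtain ⟨e, he⟩ : ∃ e : B.residueField (h.base (σ.base b)) ≅ B.residueField b,
      e.hom = h.residueFieldMap (σ.base b) ≫ σ.residueFieldMap b := ⟨_, hc⟩
  intro v
  refine ⟨e.inv.hom ((σ.residueFieldMap b).hom v), hinj ?_⟩
  rw [← CommRingCat.comp_apply, ← he, ← CommRingCat.comp_apply, Iso.inv_hom_id]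
  rfl

/-! ## §2. One separable step: extending an embedding into a separably closed field -/

/-- **Extension along a separable residue step.** For `π : X′ → X`, a point `x′`, an embedding `ε : κ(π x′) → K` into a SEPARABLY CLOSED field,
and `κ(π x′) → κ(x′)` separable (algebraic), there is `ε′ : κ(x′) → K` with `κ(π x′) → κ(x′) → K` equal to `ε` (`IsSepClosed.lift`). [folklore] -/
theorem exists_residueField_hom_comp_eq {X' X : Scheme.{u}} (π : X' ⟶ X) (x' : X') {K : Type u} [Field K] [IsSepClosed K]
    (ε : X.residueField (π.base x') ⟶ CommRingCat.of K)
    (hsep : letI := (π.residueFieldMap x').hom.toAlgebra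
      Algebra.IsSeparable (X.residueField (π.base x')) (X'.residueField x')) :
    ∃ ε' : X'.residueField x' ⟶ CommRingCat.of K, π.residueFieldMap x' ≫ ε' = ε := by
  letI : Algebra (X.residueField (π.base x')) (X'.residueField x') := (π.residueFieldMap x').hom.toAlgebra
  letI : Algebra (X.residueField (π.base x')) K := ε.hom.toAlgebra
  haveI := hsep
  let l : X'.residueField x' →ₐ[X.residueField (π.base x')] K := IsSepClosed.lift
  refine ⟨CommRingCat.ofHom l.toRingHom, ?_⟩
  ext a
  change l (algebraMap (X.residueField (π.base x')) (X'.residueField x') a) = algebraMap (X.residueField (π.base x')) K a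
  exact l.commutes a

/-- The `K`-point of `X` through `x` defined by an embedding `ε : κ(x) → K`: `Spec K → Spec κ(x) → X`; it hits `x`. [folklore] -/
theorem SpecMap_comp_fromSpecResidueField_apply {X : Scheme.{u}} (x : X) {K : Type u} [Field K]
    (ε : X.residueField x ⟶ CommRingCat.of K) (q : ↥(Spec (CommRingCat.of K))) :
    (Spec.map ε ≫ X.fromSpecResidueField x).base q = x := by
  rw [Scheme.Hom.comp_apply]
  exact Scheme.fromSpecResidueField_apply x _

/-! ## §3. `K`-rational marked points of the base-changed tower -/

namespace BlowupTower

variable (T : BlowupTower.{u}) {k K : Type u} [Field k] [Field K] [Algebra k K] [IsSepClosed K]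
  (f : T.X 0 ⟶ Spec (CommRingCat.of k))
  [Flat (pullback.fst f (Spec.map (CommRingCat.ofHom (algebraMap k K))))]
  [GeometricallyReduced (pullback.fst f (Spec.map (CommRingCat.ofHom (algebraMap k K))))]
  [IsLocallyNoetherian (pullback f (Spec.map (CommRingCat.ofHom (algebraMap k K))))]

/-- **`K`-RATIONAL MARKED POINTS of the base-changed tower.** Given marked points `x_{n+1} ↦ x_n` of `T` whose residue STEPS
`κ(x_n) → κ(x_{n+1})` are separable, a separably closed `K ⊇ k` and a `k`-compatible embedding `ε₀ : κ(x_0) → K`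
(`Spec K → Spec κ(x_0) → X_0 → Spec k` is the structure map), the base change `S_• = X_• ×_k K` has marked points `s_n` over `x_n`,
compatible with the blow-ups, which are `K`-RATIONAL: the structure map `S_n → Spec K` has a section through `s_n`, so its residue field map at
`s_n` is onto. Construction: `K`-points `Spec K → X_n` through `x_n` from embeddings `ε_n : κ(x_n) → K` extended step by step
(`exists_residueField_hom_comp_eq`), lifted to `S_{n+1} = X_{n+1} ×_{X_n} S_n` by `pullback.lift`. [folklore] -/
theorem exists_rational_markedPoints_bc (pt : ∀ n, T.X n) (hpt : ∀ n, (T.π n).base (pt (n + 1)) = pt n)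
    (hsep : ∀ n, letI := ((T.π n).residueFieldMap (pt (n + 1))).hom.toAlgebra
      Algebra.IsSeparable ((T.X n).residueField ((T.π n).base (pt (n + 1)))) ((T.X (n + 1)).residueField (pt (n + 1))))
    (ε₀ : (T.X 0).residueField (pt 0) ⟶ CommRingCat.of K)
    (hε₀ : Spec.map ε₀ ≫ (T.X 0).fromSpecResidueField (pt 0) ≫ f = Spec.map (CommRingCat.ofHom (algebraMap k K))) :
    ∃ s : ∀ n, ↥(T.bcX (pullback.fst f (Spec.map (CommRingCat.ofHom (algebraMap k K)))) n),
      (∀ n, (T.bcι (pullback.fst f (Spec.map (CommRingCat.ofHom (algebraMap k K)))) n).base (s n) = pt n) ∧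
      (∀ n, (T.bcπ (pullback.fst f (Spec.map (CommRingCat.ofHom (algebraMap k K)))) n).base (s (n + 1)) = s n) ∧
      ∀ n, Function.Surjective ((((baseChangeGR T (pullback.fst f (Spec.map (CommRingCat.ofHom (algebraMap k K))))).phi n ≫
        pullback.snd f (Spec.map (CommRingCat.ofHom (algebraMap k K)))).residueFieldMap (s n)).hom) := by
  -- the data carried along the recursion: an embedding `ε_n : κ(x_n) → K` and a section `σ_n : Spec K → S_n` with
  -- `σ_n ≫ ι_n = Spec ε_n ≫ (κ(x_n) ↪ X_n)` and `σ_n ≫ (S_n → Spec K) = 𝟙`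
  let D : ℕ → Type u := fun n =>
    Σ' (ε : (T.X n).residueField (pt n) ⟶ CommRingCat.of K) (σ : Spec (CommRingCat.of K) ⟶ T.bcX (pullback.fst f (Spec.map (CommRingCat.ofHom (algebraMap k K)))) n),
      σ ≫ T.bcι (pullback.fst f (Spec.map (CommRingCat.ofHom (algebraMap k K)))) n = Spec.map ε ≫ (T.X n).fromSpecResidueField (pt n) ∧
        σ ≫ ((baseChangeGR T (pullback.fst f (Spec.map (CommRingCat.ofHom (algebraMap k K))))).phi n ≫ pullback.snd f (Spec.map (CommRingCat.ofHom (algebraMap k K)))) = 𝟙 _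
  -- base
  have d0 : D 0 := by
    refine ⟨ε₀, pullback.lift (Spec.map ε₀ ≫ (T.X 0).fromSpecResidueField (pt 0)) (𝟙 _) (by rw [Category.assoc, hε₀, Category.id_comp]),
      pullback.lift_fst _ _ _, ?_⟩
    simp only [Literature.AlgebraicGeometry.CossartJannsenSaito2020.BlowupTower.phi_zero, Category.id_comp]
    exact pullback.lift_snd _ _ _
  -- step
  have step : ∀ n (d : D n), ∃ d' : D (n + 1), d'.2.1 ≫ T.bcπ (pullback.fst f (Spec.map (CommRingCat.ofHom (algebraMap k K)))) n = d.2.1 := by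
    intro n d
    obtain ⟨ε, σ, h1, h2⟩ := d
    -- extend `ε` (moved to the point `π x_{n+1}`) along the separable step
    obtain ⟨ε', hε'⟩ := exists_residueField_hom_comp_eq (T.π n) (pt (n + 1)) (((T.X n).residueFieldCongr (hpt n)).hom ≫ ε) (hsep n)
    -- the `K`-point of `X_{n+1}` through `x_{n+1}` and its compatibility with `σ`
    have hcompat : (Spec.map ε' ≫ (T.X (n + 1)).fromSpecResidueField (pt (n + 1))) ≫ T.π n = σ ≫ T.bcι (pullback.fst f (Spec.map (CommRingCat.ofHom (algebraMap k K)))) n := by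
      have e1 : (T.X (n + 1)).fromSpecResidueField (pt (n + 1)) ≫ T.π n =
          Spec.map ((T.π n).residueFieldMap (pt (n + 1))) ≫ (T.X n).fromSpecResidueField ((T.π n).base (pt (n + 1))) :=
        (Scheme.Hom.SpecMap_residueFieldMap_fromSpecResidueField (T.π n) (pt (n + 1))).symm
      have e2 : Spec.map ε' ≫ Spec.map ((T.π n).residueFieldMap (pt (n + 1))) =
          Spec.map ε ≫ Spec.map ((T.X n).residueFieldCongr (hpt n)).hom := by
        rw [← Spec.map_comp, ← Spec.map_comp, hε']
      calc (Spec.map ε' ≫ (T.X (n + 1)).fromSpecResidueField (pt (n + 1))) ≫ T.π n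
          = Spec.map ε' ≫ Spec.map ((T.π n).residueFieldMap (pt (n + 1))) ≫
              (T.X n).fromSpecResidueField ((T.π n).base (pt (n + 1))) := by rw [Category.assoc, e1]
        _ = Spec.map ε ≫ Spec.map ((T.X n).residueFieldCongr (hpt n)).hom ≫
              (T.X n).fromSpecResidueField ((T.π n).base (pt (n + 1))) := by rw [← Category.assoc, e2, Category.assoc]
        _ = Spec.map ε ≫ (T.X n).fromSpecResidueField (pt n) := by rw [Scheme.residueFieldCongr_fromSpecResidueField]
        _ = σ ≫ T.bcι (pullback.fst f (Spec.map (CommRingCat.ofHom (algebraMap k K)))) n := h1.symm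
    refine ⟨⟨ε', pullback.lift (Spec.map ε' ≫ (T.X (n + 1)).fromSpecResidueField (pt (n + 1))) σ hcompat,
      pullback.lift_fst _ _ _, ?_⟩, pullback.lift_snd _ _ _⟩
    rw [Literature.AlgebraicGeometry.CossartJannsenSaito2020.BlowupTower.phi_succ, Category.assoc]
    show pullback.lift _ σ hcompat ≫ T.bcπ (pullback.fst f (Spec.map (CommRingCat.ofHom (algebraMap k K)))) n ≫ (baseChangeGR T (pullback.fst f (Spec.map (CommRingCat.ofHom (algebraMap k K))))).phi n ≫ pullback.snd f (Spec.map (CommRingCat.ofHom (algebraMap k K))) = 𝟙 _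
    rw [pullback.lift_snd_assoc]
    exact h2
  -- the recursion
  let d : ∀ n, D n := fun n => Nat.rec (motive := D) d0 (fun n dn => Classical.choose (step n dn)) n
  have hd : ∀ n, (d (n + 1)).2.1 ≫ T.bcπ (pullback.fst f (Spec.map (CommRingCat.ofHom (algebraMap k K)))) n = (d n).2.1 := fun n => Classical.choose_spec (step n (d n))
  let q : ↥(Spec (CommRingCat.of K)) := default
  refine ⟨fun n => (d n).2.1.base q, fun n => ?_, fun n => ?_, fun n => ?_⟩
  · rw [← Scheme.Hom.comp_apply, (d n).2.2.1]
    exact SpecMap_comp_fromSpecResidueField_apply (pt n) (d n).1 q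
  · rw [← Scheme.Hom.comp_apply, hd n]
  · exact surjective_residueFieldMap_of_section _ (d n).2.1 (d n).2.2.2 q

end BlowupTower

/-! ## §4. THE K2-sep THEOREM -/

/-- **K2-sep (separable residue steps): AN ISOLATED POINT TOWER WITH SEPARABLE RESIDUE STEPS IS NOT EVERYWHERE FREE.** Let `(X_0, x_0)` be a
maximal origin at level `3`, value `ν`, characteristic `p`, presented by `f : X_0 → Spec k` (separated, locally of finite type, quasi-compact,
`char k = p`); `(T, pt)` an isolated point tower over it all of whose residue steps `κ(x_n) → κ(x_{n+1})` are SEPARABLE; `K ⊇ k` separable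
algebraic and separably closed (e.g. `k^{sep}`) with a `k`-compatible embedding `ε₀ : κ(x_0) → K`. Then NOT every step is non-satellite.
Proof: base change to `K` (`BlowupTower.baseChangeGR`); the `K`-rational marked points of `exists_rational_markedPoints_bc` make every base-changed
step rational (`isRationalStep_baseChangeGR_of_surjective`); satellites are invariant (`isSatelliteStep_baseChangeGR_iff`); K1 à la carte
(`false_of_isIsoPointTower_baseChangeGR_of_forall_free`). With `stub_isoSepRecurrent`.2 (no satellite recurrence) this is `.1` of
`stub_isoSepRecurrent` on towers with separable residue steps, read after the last satellite step. [OURS · L1 W4.2; AI-written]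
[cite: CossartJannsenSaito2020, Def. 6.38, p. 107] [cite: CossartPiltant2009, ch. 3 I.9] -/
theorem false_of_isIsoPointTower_of_separableSteps_of_forall_free {p : ℕ} {ν : ℕ → ℕ} {k K : Type u} [Field k] [CharP k p]
    [Field K] [Algebra k K] [Algebra.IsSeparable k K] [IsSepClosed K] {T : BlowupTower.{u}} {pt : ∀ n, T.X n}
    (f : T.X 0 ⟶ Spec (CommRingCat.of k)) [IsSeparated f] [LocallyOfFiniteType f] [QuasiCompact f]
    (hO : IsMaximalOrigin p 3 ν (T.X 0) (pt 0)) (hT : IsIsoPointTower 3 ν T pt)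
    (hsep : ∀ n, letI := ((T.π n).residueFieldMap (pt (n + 1))).hom.toAlgebra
      Algebra.IsSeparable ((T.X n).residueField ((T.π n).base (pt (n + 1)))) ((T.X (n + 1)).residueField (pt (n + 1))))
    (ε₀ : (T.X 0).residueField (pt 0) ⟶ CommRingCat.of K)
    (hε₀ : Spec.map ε₀ ≫ (T.X 0).fromSpecResidueField (pt 0) ≫ f = Spec.map (CommRingCat.ofHom (algebraMap k K)))
    (hnsat : ∀ n, ¬ IsSatelliteStep T pt n) : False := by
  haveI : IsLocallyNoetherian (T.X 0) := T.ln 0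
  haveI := geometricallyReduced_SpecMap_algebraMap_of_isSeparable k K
  haveI : Flat (Spec.map (CommRingCat.ofHom (algebraMap k K))) := by
    rw [HasRingHomProperty.Spec_iff (P := @Flat), CommRingCat.hom_ofHom, RingHom.flat_algebraMap_iff]; infer_instance
  haveI : Flat (pullback.fst f (Spec.map (CommRingCat.ofHom (algebraMap k K)))) := inferInstance
  haveI : GeometricallyReduced (pullback.fst f (Spec.map (CommRingCat.ofHom (algebraMap k K)))) := inferInstance
  haveI := isLocallyNoetherian_pullback_SpecMap (K := K) f
  obtain ⟨s, hι, hsπ, hK⟩ := BlowupTower.exists_rational_markedPoints_bc T f pt hT.2.1 hsep ε₀ hε₀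
  exact false_of_isIsoPointTower_baseChangeGR_of_forall_free f hO hT s hι hsπ
    (fun n => BlowupTower.isRationalStep_baseChangeGR_of_surjective T f s n (hK (n + 1))) hnsat

/-- **K2-sep, intrinsic form (base change to the separable closure `k^{sep}`).** As `false_of_isIsoPointTower_of_separableSteps_of_forall_free`
with `K := SeparableClosure k`, the embedding `κ(x_0) → k^{sep}` being produced from the SEPARABILITY of `κ(x_0)/k` (`IsSepClosed.lift`); the
`k`-structure of `κ(x_0)` is read through any `φ₀ : k → κ(x_0)` with `Spec κ(x_0) → X_0 → Spec k = Spec φ₀` (e.g. `φ₀ := Spec.preimage _`).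
So: over a maximal origin, an isolated point tower whose residue field `κ(x_0)` is separable over `k` and whose residue STEPS are separable has a
SATELLITE step. [OURS · L1 W4.2; AI-written] [cite: CossartJannsenSaito2020, Def. 6.38, p. 107] [cite: CossartPiltant2009, ch. 3 I.9] -/
theorem exists_isSatelliteStep_of_isIsoPointTower_of_separableSteps {p : ℕ} {ν : ℕ → ℕ} {k : Type u} [Field k] [CharP k p]
    {T : BlowupTower.{u}} {pt : ∀ n, T.X n} (f : T.X 0 ⟶ Spec (CommRingCat.of k)) [IsSeparated f] [LocallyOfFiniteType f] [QuasiCompact f]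
    (hO : IsMaximalOrigin p 3 ν (T.X 0) (pt 0)) (hT : IsIsoPointTower 3 ν T pt)
    (φ₀ : CommRingCat.of k ⟶ (T.X 0).residueField (pt 0)) (hφ₀ : (T.X 0).fromSpecResidueField (pt 0) ≫ f = Spec.map φ₀)
    (hsep₀ : letI := φ₀.hom.toAlgebra; Algebra.IsSeparable k ((T.X 0).residueField (pt 0)))
    (hsep : ∀ n, letI := ((T.π n).residueFieldMap (pt (n + 1))).hom.toAlgebra
      Algebra.IsSeparable ((T.X n).residueField ((T.π n).base (pt (n + 1)))) ((T.X (n + 1)).residueField (pt (n + 1)))) :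
    ∃ n, IsSatelliteStep T pt n := by
  by_contra hns
  letI : Algebra k ((T.X 0).residueField (pt 0)) := φ₀.hom.toAlgebra
  haveI := hsep₀
  let l : (T.X 0).residueField (pt 0) →ₐ[k] SeparableClosure k := IsSepClosed.lift
  have hl : φ₀ ≫ CommRingCat.ofHom l.toRingHom = CommRingCat.ofHom (algebraMap k (SeparableClosure k)) := by
    apply CommRingCat.hom_ext
    apply RingHom.ext
    intro a
    exact l.commutes a
  refine false_of_isIsoPointTower_of_separableSteps_of_forall_free (K := SeparableClosure k) f hO hT hsep (CommRingCat.ofHom l.toRingHom)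
    ?_ (fun n hn => hns ⟨n, hn⟩)
  rw [hφ₀, ← Spec.map_comp, hl]

/-! ## §5. Satellite RECURRENCE on towers with separable residues (the row-level reading) -/

/-- Transport of the `k`-structure of the residue fields along the tower: from `φ₀ : k → κ(x_0)` with `Spec κ(x_0) → X_0 → Spec k = Spec φ₀`
and the residue steps, a `k`-structure `φ_a : k → κ(x_a)` at every stage with `Spec κ(x_a) → X_a → X_0 → Spec k = Spec φ_a`, separable over `k`
when `κ(x_0)/k` and all steps are separable (transitivity of separability). [folklore] -/
theorem exists_residueField_structure_stage {k : Type u} [Field k] {T : BlowupTower.{u}} {pt : ∀ n, T.X n}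
    (f : T.X 0 ⟶ Spec (CommRingCat.of k)) (hpt : ∀ n, (T.π n).base (pt (n + 1)) = pt n)
    (φ₀ : CommRingCat.of k ⟶ (T.X 0).residueField (pt 0)) (hφ₀ : (T.X 0).fromSpecResidueField (pt 0) ≫ f = Spec.map φ₀)
    (hsep₀ : letI := φ₀.hom.toAlgebra; Algebra.IsSeparable k ((T.X 0).residueField (pt 0)))
    (hsep : ∀ n, letI := ((T.π n).residueFieldMap (pt (n + 1))).hom.toAlgebra
      Algebra.IsSeparable ((T.X n).residueField ((T.π n).base (pt (n + 1)))) ((T.X (n + 1)).residueField (pt (n + 1)))) (a : ℕ) :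
    ∃ φ : CommRingCat.of k ⟶ (T.X a).residueField (pt a),
      (T.X a).fromSpecResidueField (pt a) ≫ T.phi a ≫ f = Spec.map φ ∧
      (letI := φ.hom.toAlgebra; Algebra.IsSeparable k ((T.X a).residueField (pt a))) := by
  induction a with
  | zero => exact ⟨φ₀, by rw [T.phi_zero, Category.id_comp]; exact hφ₀, hsep₀⟩
  | succ a ih =>
    obtain ⟨φ, hφ, hsφ⟩ := ih
    -- the `k`-structure at stage `a+1`: `k → κ(x_a) ≅ κ(π x_{a+1}) → κ(x_{a+1})`
    let ψ : (T.X a).residueField (pt a) ⟶ (T.X (a + 1)).residueField (pt (a + 1)) :=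
      ((T.X a).residueFieldCongr (hpt a)).inv ≫ (T.π a).residueFieldMap (pt (a + 1))
    refine ⟨φ ≫ ψ, ?_, ?_⟩
    · have e1 : (T.X (a + 1)).fromSpecResidueField (pt (a + 1)) ≫ T.π a =
          Spec.map ((T.π a).residueFieldMap (pt (a + 1))) ≫ (T.X a).fromSpecResidueField ((T.π a).base (pt (a + 1))) :=
        (Scheme.Hom.SpecMap_residueFieldMap_fromSpecResidueField (T.π a) (pt (a + 1))).symm
      have e2 : (T.X a).fromSpecResidueField ((T.π a).base (pt (a + 1))) =
          Spec.map ((T.X a).residueFieldCongr (hpt a)).inv ≫ (T.X a).fromSpecResidueField (pt a) := by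
        rw [← Scheme.residueFieldCongr_fromSpecResidueField (hpt a), ← Spec.map_comp_assoc, Iso.hom_inv_id, Spec.map_id,
          Category.id_comp]
      calc (T.X (a + 1)).fromSpecResidueField (pt (a + 1)) ≫ T.phi (a + 1) ≫ f
          = ((T.X (a + 1)).fromSpecResidueField (pt (a + 1)) ≫ T.π a) ≫ T.phi a ≫ f := by
            rw [T.phi_succ, Category.assoc, Category.assoc]
        _ = Spec.map ((T.π a).residueFieldMap (pt (a + 1))) ≫ Spec.map ((T.X a).residueFieldCongr (hpt a)).inv ≫
              ((T.X a).fromSpecResidueField (pt a) ≫ T.phi a ≫ f) := by rw [e1, e2]; simp only [Category.assoc]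
        _ = Spec.map (φ ≫ ψ) := by rw [hφ, ← Spec.map_comp, ← Spec.map_comp]; rfl
    · -- separability: `k → κ(x_a)` separable, `κ(x_a) → κ(x_{a+1})` separable (up to the congruence iso), tower
      letI : Algebra k ((T.X a).residueField (pt a)) := φ.hom.toAlgebra
      letI : Algebra ((T.X a).residueField (pt a)) ((T.X (a + 1)).residueField (pt (a + 1))) := ψ.hom.toAlgebra
      letI : Algebra k ((T.X (a + 1)).residueField (pt (a + 1))) := (φ ≫ ψ).hom.toAlgebra
      haveI : IsScalarTower k ((T.X a).residueField (pt a)) ((T.X (a + 1)).residueField (pt (a + 1))) :=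
        IsScalarTower.of_algebraMap_eq fun x => rfl
      haveI := hsφ
      haveI : Algebra.IsSeparable ((T.X a).residueField (pt a)) ((T.X (a + 1)).residueField (pt (a + 1))) := by
        -- transport `hsep a` along the isomorphism `κ(π x_{a+1}) ≅ κ(x_a)`
        letI : Algebra ((T.X a).residueField ((T.π a).base (pt (a + 1)))) ((T.X (a + 1)).residueField (pt (a + 1))) :=
          ((T.π a).residueFieldMap (pt (a + 1))).hom.toAlgebra
        haveI := hsep a
        let e : (T.X a).residueField ((T.π a).base (pt (a + 1))) ≃+* (T.X a).residueField (pt a) :=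
          ((T.X a).residueFieldCongr (hpt a)).commRingCatIsoToRingEquiv
        letI : Algebra ((T.X a).residueField ((T.π a).base (pt (a + 1)))) ((T.X a).residueField (pt a)) := e.toRingHom.toAlgebra
        haveI : IsScalarTower ((T.X a).residueField ((T.π a).base (pt (a + 1)))) ((T.X a).residueField (pt a))
            ((T.X (a + 1)).residueField (pt (a + 1))) := by
          refine IsScalarTower.of_algebraMap_eq fun x => ?_
          change ((T.π a).residueFieldMap (pt (a + 1))).hom x =
            ψ.hom (((T.X a).residueFieldCongr (hpt a)).hom.hom x)
          change _ = ((T.π a).residueFieldMap (pt (a + 1))).hom (((T.X a).residueFieldCongr (hpt a)).inv.hom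
            (((T.X a).residueFieldCongr (hpt a)).hom.hom x))
          rw [← CommRingCat.comp_apply ((T.X a).residueFieldCongr (hpt a)).hom, Iso.hom_inv_id]
          rfl
        exact Algebra.isSeparable_tower_top_of_isSeparable ((T.X a).residueField ((T.π a).base (pt (a + 1))))
          ((T.X a).residueField (pt a)) ((T.X (a + 1)).residueField (pt (a + 1)))
      exact Algebra.IsSeparable.trans k ((T.X a).residueField (pt a)) ((T.X (a + 1)).residueField (pt (a + 1)))

/-- **SEPARABLE RESIDUES ⟹ SATELLITE-RECURRENT.** Over a maximal origin `(X_0, x_0)` presented by `f : X_0 → Spec k` (separated, locally of finite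
type, quasi-compact), an isolated point tower whose residue field `κ(x_0)` is separable over `k` (through some / any `φ₀` with
`Spec κ(x_0) → X_0 → Spec k = Spec φ₀`) and whose residue STEPS are all separable has satellite steps BEYOND EVERY STAGE (apply
`exists_isSatelliteStep_of_isIsoPointTower_of_separableSteps` to the tails `T.drop a`). Consequently `stub_isoSepRecurrent`.2
(`IsoSepSatelliteRecurrentImpossible`) excludes such towers, and `.1` holds for them. [OURS · L1 W4.2; AI-written]
[cite: CossartJannsenSaito2020, Def. 6.38, Def. 6.39, p. 107] [cite: CossartPiltant2009, ch. 3 I.9] -/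
theorem satelliteRecurrent_of_isIsoPointTower_of_separableSteps {p : ℕ} {ν : ℕ → ℕ} {k : Type u} [Field k] [CharP k p]
    {T : BlowupTower.{u}} {pt : ∀ n, T.X n} (f : T.X 0 ⟶ Spec (CommRingCat.of k)) [IsSeparated f] [LocallyOfFiniteType f] [QuasiCompact f]
    (hO : IsMaximalOrigin p 3 ν (T.X 0) (pt 0)) (hT : IsIsoPointTower 3 ν T pt)
    (φ₀ : CommRingCat.of k ⟶ (T.X 0).residueField (pt 0)) (hφ₀ : (T.X 0).fromSpecResidueField (pt 0) ≫ f = Spec.map φ₀)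
    (hsep₀ : letI := φ₀.hom.toAlgebra; Algebra.IsSeparable k ((T.X 0).residueField (pt 0)))
    (hsep : ∀ n, letI := ((T.π n).residueFieldMap (pt (n + 1))).hom.toAlgebra
      Algebra.IsSeparable ((T.X n).residueField ((T.π n).base (pt (n + 1)))) ((T.X (n + 1)).residueField (pt (n + 1)))) :
    ∀ a, ∃ n, a ≤ n ∧ IsSatelliteStep T pt n := by
  intro a
  obtain ⟨φ, hφ, hsφ⟩ := exists_residueField_structure_stage f hT.2.1 φ₀ hφ₀ hsep₀ hsep a
  haveI : IsSeparated (T.phi a) := BlowupTower.isSeparated_phi T a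
  haveI : LocallyOfFiniteType (T.phi a) :=
    Summit.ResolutionOfSingularities.ResolutionOfSingularities.Cruxes.SigmaMaxModifications.IdeasL1C5.locallyOfFiniteType_phi T a
  haveI : QuasiCompact (T.phi a) := BlowupTower.quasiCompact_phi T a
  haveI : @IsSeparated ((T.drop a).X 0) (Spec (CommRingCat.of k)) (T.phi a ≫ f) := inferInstanceAs (IsSeparated (T.phi a ≫ f))
  haveI : @LocallyOfFiniteType ((T.drop a).X 0) (Spec (CommRingCat.of k)) (T.phi a ≫ f) :=
    inferInstanceAs (LocallyOfFiniteType (T.phi a ≫ f))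
  haveI : @QuasiCompact ((T.drop a).X 0) (Spec (CommRingCat.of k)) (T.phi a ≫ f) := inferInstanceAs (QuasiCompact (T.phi a ≫ f))
  obtain ⟨n, hn⟩ := exists_isSatelliteStep_of_isIsoPointTower_of_separableSteps (T := T.drop a) (pt := fun n => pt (a + n))
    (T.phi a ≫ f) (hT.isMaximalOrigin_drop hO a) (hT.drop a) φ hφ hsφ (fun n => hsep (a + n))
  exact ⟨a + n, Nat.le_add_right a n, (isSatelliteStep_drop_iff T pt a n).mp hn⟩

/-- **`.1` ON SEPARABLE-RESIDUE TOWERS FROM `.2`** (the reduction promised in the design memo): granted `stub_isoSepRecurrent`.2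
(`IsoSepSatelliteRecurrentImpossible p 3`: no satellite recurrence on eventually-non-inseparable isolated towers), an isolated point tower over a
maximal origin with separable residue field and separable residue steps that is eventually non-inseparable cannot exist at all — so in
particular it has no residue-jump recurrence (the conclusion of `IsoSepJumpRecurrentImpossible` for it).
[OURS · L1 W4.2; AI-written] [cite: CossartJannsenSaito2020, Def. 6.38] [cite: CossartPiltant2009, ch. 4 II.4 (pointer)] -/
theorem not_jumpRecurrent_of_separableSteps_of_isoSepSatelliteRecurrentImpossible {p : ℕ} {ν : ℕ → ℕ} {k : Type u} [Field k] [CharP k p]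
    (h2 : IsoSepSatelliteRecurrentImpossible.{u} p 3)
    {T : BlowupTower.{u}} {pt : ∀ n, T.X n} (f : T.X 0 ⟶ Spec (CommRingCat.of k)) [IsSeparated f] [LocallyOfFiniteType f] [QuasiCompact f]
    (hO : IsMaximalOrigin p 3 ν (T.X 0) (pt 0)) (hT : IsIsoPointTower 3 ν T pt)
    (φ₀ : CommRingCat.of k ⟶ (T.X 0).residueField (pt 0)) (hφ₀ : (T.X 0).fromSpecResidueField (pt 0) ≫ f = Spec.map φ₀)
    (hsep₀ : letI := φ₀.hom.toAlgebra; Algebra.IsSeparable k ((T.X 0).residueField (pt 0)))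
    (hsep : ∀ n, letI := ((T.π n).residueFieldMap (pt (n + 1))).hom.toAlgebra
      Algebra.IsSeparable ((T.X n).residueField ((T.π n).base (pt (n + 1)))) ((T.X (n + 1)).residueField (pt (n + 1))))
    (hev : ∃ n₀, ∀ n, n₀ ≤ n → ¬ IsInsepStage T pt n) :
    ¬ ∀ n₀, ∃ n, n₀ ≤ n ∧ ¬ IsRationalStep T pt n :=
  fun _ => h2 ν T pt hO hT hev (satelliteRecurrent_of_isIsoPointTower_of_separableSteps f hO hT φ₀ hφ₀ hsep₀ hsep)

end Summit.ResolutionOfSingularities.ResolutionOfSingularities.Theorems.SigmaMaxModificationsCorridor3.IsoTailsHS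

end
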